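import Summits.CriticalPhenomena.CardyFormulaZ2.Theorems.CardySusyWardDiscretisationFamilyExistsWinding
import Mathlib.Combinatorics.SimpleGraph.Connectivity.Connected
import HarnessLib

/-!
# The two cut edges separate the boundary graph — helper for `DiscretisationFamilyExists` (stmt-CriticalPhenomena-9644)

Let `Ω` be a regular domain (open, exterior connected and unbounded with `∂Ω` in its closure —
every Jordan domain) and `δ > 0`.  The **boundary graph** is the graph of `Ω_δ`-edges between
sites of the square-lattice boundary `zdBoundary` (here: `(discreteDomainGraph Ω δ).induce
zdBoundary`).  Let `e_a = (u_a, u_a + cornerUnit k_a)` and `e_b` be two distinct face-boundary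
darts (`IsOutEdge`: inner face `faceAt u k` on the left, non-inner face `faceAt u (k + 3)` on the
right) whose inner faces are joined by a chain of SIDE STEPS ACROSS NON-CHORDS — sides whose two
endpoints are not both boundary sites.  Then (`not_reachable_deleteEdges_of_isOutEdge`) in the
boundary graph with the two edges `e_a`, `e_b` deleted, the head of `e_a` is NOT joined to its
tail.

Proof (combinatorial winding numbers, `LatticeLoopWinding` / `…ExistsWinding`): a joining walk
closed up by `e_a` is a closed walk of `Ω_δ`-edges between boundary sites traversing `e_a` once and
`e_b` never; the winding number is `0` on the two (non-inner) right faces, jumps by one across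
`e_a`, does not jump across `e_b`, and does not jump across the non-chord sides of the chain (the
walk only uses edges between boundary sites) — so it would be both `1` and `0` on the left face of
`e_b`.

Also: the generic jump lemmas `W_faceAt_eq_add_one_of_cnt`, `W_faceAt_eq_of_cnt` (the winding
number across the edge at `x` in direction `k`, from its traversal counts).
-/

noncomputable section

namespace Summit.CriticalPhenomena.CardyFormulaZ2.Theorems.DiscretisationFamilyExists

open Set Relation SimpleGraph Literature.Probability.LatticeModels Literature.Topology.PlaneTopology
  Literature.Probability.LatticeModels.DiscreteDobrushin

variable {n : ℕ}

/-! ### Jumps of the winding number across the edge at `x` in direction `k` -/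

/-- The four elements of `Fin 4`. [folklore] -/
private theorem fin4_cases' (k : Fin 4) : k = 0 ∨ k = 1 ∨ k = 2 ∨ k = 3 := by revert k; decide

/-- **Jump by one**: if a closed lattice walk traverses the edge from `x` to `x + cornerUnit k`
exactly once and never backwards, the face `faceAt x k` on its left has winding number one more
than the face `faceAt x (k + 3)` on its right. [folklore] -/
theorem W_faceAt_eq_add_one_of_cnt (c : ClosedWalk n) {x : Site 2} {k : Fin 4}
    (hf : c.cnt (toZ2 x) (toZ2 (x + cornerUnit k)) = 1) (hr : c.cnt (toZ2 (x + cornerUnit k)) (toZ2 x) = 0) :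
    c.W (toZ2 (faceAt x k)) = c.W (toZ2 (faceAt x (k + 3))) + 1 := by
  obtain rfl | rfl | rfl | rfl := fin4_cases' k
  · rw [toZ2_add_cornerUnit_zero, toZ2_mk] at hf hr
    rw [show (0 : Fin 4) + 3 = 3 from rfl, toZ2_faceAt_zero, toZ2_faceAt_three]
    have hj := c.W_succ_snd (x 0) (x 1 - 1)
    rw [sub_add_cancel, c.cH_eq_cnt, hf, hr] at hj
    linarith
  · rw [toZ2_add_cornerUnit_one, toZ2_mk] at hf hr
    rw [show (1 : Fin 4) + 3 = 0 from rfl, toZ2_faceAt_one, toZ2_faceAt_zero]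
    have hj := c.W_succ_fst (x 0 - 1) (x 1)
    rw [sub_add_cancel, c.cV_eq_cnt, hf, hr] at hj
    linarith
  · rw [toZ2_add_cornerUnit_two, toZ2_mk] at hf hr
    rw [show (2 : Fin 4) + 3 = 1 from rfl, toZ2_faceAt_two, toZ2_faceAt_one]
    have hj := c.W_succ_snd (x 0 - 1) (x 1 - 1)
    rw [sub_add_cancel, c.cH_eq_cnt, sub_add_cancel, hf, hr] at hj
    linarith
  · rw [toZ2_add_cornerUnit_three, toZ2_mk] at hf hr
    rw [show (3 : Fin 4) + 3 = 2 from rfl, toZ2_faceAt_three, toZ2_faceAt_two]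
    have hj := c.W_succ_fst (x 0 - 1) (x 1 - 1)
    rw [sub_add_cancel, c.cV_eq_cnt, sub_add_cancel, hf, hr] at hj
    linarith

/-- **No jump**: if a closed lattice walk traverses the edge from `x` to `x + cornerUnit k` in
neither direction, its two faces have the same winding number. [folklore] -/
theorem W_faceAt_eq_of_cnt (c : ClosedWalk n) {x : Site 2} {k : Fin 4}
    (hf : c.cnt (toZ2 x) (toZ2 (x + cornerUnit k)) = 0) (hr : c.cnt (toZ2 (x + cornerUnit k)) (toZ2 x) = 0) :
    c.W (toZ2 (faceAt x k)) = c.W (toZ2 (faceAt x (k + 3))) := by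
  obtain rfl | rfl | rfl | rfl := fin4_cases' k
  · rw [toZ2_add_cornerUnit_zero, toZ2_mk] at hf hr
    rw [show (0 : Fin 4) + 3 = 3 from rfl, toZ2_faceAt_zero, toZ2_faceAt_three]
    have hj := c.W_succ_snd (x 0) (x 1 - 1)
    rw [sub_add_cancel, c.cH_eq_cnt, hf, hr] at hj
    linarith
  · rw [toZ2_add_cornerUnit_one, toZ2_mk] at hf hr
    rw [show (1 : Fin 4) + 3 = 0 from rfl, toZ2_faceAt_one, toZ2_faceAt_zero]
    have hj := c.W_succ_fst (x 0 - 1) (x 1)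
    rw [sub_add_cancel, c.cV_eq_cnt, hf, hr] at hj
    linarith
  · rw [toZ2_add_cornerUnit_two, toZ2_mk] at hf hr
    rw [show (2 : Fin 4) + 3 = 1 from rfl, toZ2_faceAt_two, toZ2_faceAt_one]
    have hj := c.W_succ_snd (x 0 - 1) (x 1 - 1)
    rw [sub_add_cancel, c.cH_eq_cnt, sub_add_cancel, hf, hr] at hj
    linarith
  · rw [toZ2_add_cornerUnit_three, toZ2_mk] at hf hr
    rw [show (3 : Fin 4) + 3 = 2 from rfl, toZ2_faceAt_three, toZ2_faceAt_two]
    have hj := c.W_succ_fst (x 0 - 1) (x 1 - 1)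
    rw [sub_add_cancel, c.cV_eq_cnt, sub_add_cancel, hf, hr] at hj
    linarith

/-- `Ω_δ`-adjacent sites differ by a unit vector. [folklore] -/
theorem exists_eq_add_cornerUnit_of_adj {E : DiscreteDobrushin} {x y : Site 2}
    (h : (discreteDomainGraph E.Ω E.δ).Adj x y) : ∃ k, y = x + cornerUnit k :=
  exists_eq_add_cornerUnit (meshGraph_le_zdGraph _ _ (discreteDomainGraph_le_meshGraph _ _ h))

/-! ### The cut lemma -/

/-- **The two cut edges separate the boundary graph.** See the module docstring: regular domain,
positive mesh, two distinct face-boundary darts `(u_a, k_a)`, `(u_b, k_b)` whose inner (left) faces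
are joined by side steps across sides whose endpoints are not both in `zdBoundary`; then in the
graph of `Ω_δ`-edges between boundary sites with the two edges deleted, `u_a + cornerUnit k_a` is
not joined to `u_a`. [folklore] -/
theorem not_reachable_deleteEdges_of_isOutEdge {E : DiscreteDobrushin} (hδ : 0 < E.δ)
    (hΩo : IsOpen E.Ω) (hext : IsConnected (closure E.Ω)ᶜ) (hunb : ¬ Bornology.IsBounded (closure E.Ω)ᶜ)
    (hfr : frontier E.Ω ⊆ closure (closure E.Ω)ᶜ)
    {ua : Site 2} {ka : Fin 4} (ha : E.IsOutEdge ua ka) {ub : Site 2} {kb : Fin 4} (hb : E.IsOutEdge ub kb)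
    (hab : s(ua, ua + cornerUnit ka) ≠ s(ub, ub + cornerUnit kb))
    (hreach : ReflTransGen (fun f f' : Site 2 =>
        (f' = f + cornerUnit 0 ∧ ¬ (f + cornerUnit 0 ∈ E.zdBoundary ∧ f + cornerUnit 0 + cornerUnit 1 ∈ E.zdBoundary)) ∨
        (f = f' + cornerUnit 0 ∧ ¬ (f' + cornerUnit 0 ∈ E.zdBoundary ∧ f' + cornerUnit 0 + cornerUnit 1 ∈ E.zdBoundary)) ∨
        (f' = f + cornerUnit 1 ∧ ¬ (f + cornerUnit 1 ∈ E.zdBoundary ∧ f + cornerUnit 0 + cornerUnit 1 ∈ E.zdBoundary)) ∨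
        (f = f' + cornerUnit 1 ∧ ¬ (f' + cornerUnit 1 ∈ E.zdBoundary ∧ f' + cornerUnit 0 + cornerUnit 1 ∈ E.zdBoundary)))
      (faceAt ua ka) (faceAt ub kb))
    (hua : ua ∈ E.zdBoundary) (hva : ua + cornerUnit ka ∈ E.zdBoundary)
    (hub : ub ∈ E.zdBoundary) (hvb : ub + cornerUnit kb ∈ E.zdBoundary) :
    ¬ (((discreteDomainGraph E.Ω E.δ).induce E.zdBoundary).deleteEdges
        {s(⟨ua, hua⟩, ⟨ua + cornerUnit ka, hva⟩), s(⟨ub, hub⟩, ⟨ub + cornerUnit kb, hvb⟩)}).Reachable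
      ⟨ua + cornerUnit ka, hva⟩ ⟨ua, hua⟩ := by
  classical
  rintro ⟨p⟩
  set B := E.zdBoundary with hB
  set G := discreteDomainGraph E.Ω E.δ with hG
  set va := ua + cornerUnit ka with hva'
  set vb := ub + cornerUnit kb with hvb'
  set L := p.length with hL
  set N := L + 1 with hN
  have hN0 : 0 < N := Nat.succ_pos _
  -- the vertices of the closed-up walk
  set w : ℕ → Site 2 := fun j => (p.getVert (j % N)).1 with hw
  have hwB : ∀ j, w j ∈ B := fun j => (p.getVert (j % N)).2
  have hw0 : ∀ j, j % N = 0 → w j = va := fun j hj => by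
    simp only [hw, hj, Walk.getVert_zero]; rfl
  have hpL : p.getVert L = ⟨ua, hua⟩ := Walk.getVert_length p
  have hwL : ∀ j, j % N = L → w j = ua := fun j hj => by
    simp only [hw, hj, hpL]
  -- index bookkeeping: either an inner step of `p` or the closing step `u_a → v_a`
  have hidx : ∀ j, (j % N < L ∧ (j + 1) % N = j % N + 1) ∨ (j % N = L ∧ (j + 1) % N = 0) := by
    intro j
    have h1 : (j + 1) % N = (j % N + 1) % N := (Nat.mod_add_mod j N 1).symm
    have hlt : j % N < N := Nat.mod_lt _ hN0
    rcases Nat.lt_or_ge (j % N + 1) N with h | h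
    · exact Or.inl ⟨by omega, by rw [h1, Nat.mod_eq_of_lt h]⟩
    · refine Or.inr ⟨by omega, ?_⟩
      rw [h1, show j % N + 1 = N by omega, Nat.mod_self]
  -- inner steps are edges of the boundary graph other than `e_a`, `e_b`
  have hinner : ∀ j, j % N < L → (j + 1) % N = j % N + 1 →
      G.Adj (w j) (w (j + 1)) ∧ s(w j, w (j + 1)) ≠ s(ua, va) ∧ s(w j, w (j + 1)) ≠ s(ub, vb) := by
    intro j hj hj1
    have hadj := p.adj_getVert_succ (i := j % N) hj
    rw [deleteEdges_adj] at hadj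
    obtain ⟨hadj, hne⟩ := hadj
    simp only [Set.mem_insert_iff, Set.mem_singleton_iff, not_or] at hne
    have hadjG : G.Adj (p.getVert (j % N)).1 (p.getVert (j % N + 1)).1 := hadj
    refine ⟨by simp only [hw, hj1]; exact hadjG, ?_, ?_⟩
    · intro h
      apply hne.1
      simp only [hw, hj1] at h
      rw [Sym2.eq_iff] at h ⊢
      rcases h with ⟨h1, h2⟩ | ⟨h1, h2⟩
      · exact Or.inl ⟨Subtype.ext h1, Subtype.ext h2⟩
      · exact Or.inr ⟨Subtype.ext h1, Subtype.ext h2⟩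
    · intro h
      apply hne.2
      simp only [hw, hj1] at h
      rw [Sym2.eq_iff] at h ⊢
      rcases h with ⟨h1, h2⟩ | ⟨h1, h2⟩
      · exact Or.inl ⟨Subtype.ext h1, Subtype.ext h2⟩
      · exact Or.inr ⟨Subtype.ext h1, Subtype.ext h2⟩
  have hadjG : ∀ j, G.Adj (w j) (w (j + 1)) := by
    intro j
    rcases hidx j with ⟨hj, hj1⟩ | ⟨hj, hj1⟩
    · exact (hinner j hj hj1).1
    · rw [hwL j hj, hw0 (j + 1) hj1]
      exact adj_of_isInnerFace_faceAt ha.1 (Or.inl rfl)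
  -- the closed lattice walk
  let c : ClosedWalk N :=
    { v := fun j => toZ2 (w j)
      periodic := fun j => by simp only [hw, Nat.add_mod_right]
      adj := fun j => by
        obtain ⟨k, hk⟩ := exists_eq_add_cornerUnit_of_adj (hadjG j)
        exact ⟨k, by rw [hk, toZ2_add_cornerUnit]⟩ }
  have hcv : ∀ j, c.v j = toZ2 (w j) := fun j => rfl
  -- traversal counts
  have hstep_iff : ∀ (j : ℕ) (P Q : Site 2), (c.v j = toZ2 P ∧ c.v (j + 1) = toZ2 Q) ↔ (w j = P ∧ w (j + 1) = Q) := by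
    intro j P Q
    simp only [hcv, toZ2_injective.eq_iff]
  have hcnt_a : c.cnt (toZ2 ua) (toZ2 va) = 1 := by
    unfold ClosedWalk.cnt
    rw [Finset.sum_eq_single_of_mem L (Finset.mem_range.2 (Nat.lt_succ_self L))]
    · rw [indZ_of_pos]
      rw [hstep_iff]
      exact ⟨hwL L (Nat.mod_eq_of_lt (Nat.lt_succ_self L)),
        hw0 (L + 1) (by rw [hN, Nat.mod_self])⟩
    · intro j hj hjL
      rw [Finset.mem_range] at hj
      rw [indZ_of_neg]
      rw [hstep_iff]
      rintro ⟨h1, h2⟩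
      have hj' : j % N < L := by rw [Nat.mod_eq_of_lt hj]; omega
      have hj1 : (j + 1) % N = j % N + 1 := by
        rw [Nat.mod_eq_of_lt hj, Nat.mod_eq_of_lt (by omega)]
      exact (hinner j hj' hj1).2.1 (by rw [h1, h2])
  have hno : ∀ (P Q : Site 2), (s(P, Q) = s(ua, va) ∨ s(P, Q) = s(ub, vb)) → ¬ (P = ua ∧ Q = va) →
      ∀ j, ¬ (c.v j = toZ2 P ∧ c.v (j + 1) = toZ2 Q) := by
    intro P Q hPQ hne j
    rw [hstep_iff]
    rintro ⟨h1, h2⟩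
    rcases hidx j with ⟨hj, hj1⟩ | ⟨hj, hj1⟩
    · obtain ⟨-, h3, h4⟩ := hinner j hj hj1
      rw [h1, h2] at h3 h4
      rcases hPQ with h | h
      · exact h3 h
      · exact h4 h
    · rw [hwL j hj] at h1
      rw [hw0 (j + 1) hj1] at h2
      exact hne ⟨h1.symm, h2.symm⟩
  have huava : ua ≠ va := (adj_of_isInnerFace_faceAt ha.1 (Or.inl rfl)).ne
  have hcnt_a' : c.cnt (toZ2 va) (toZ2 ua) = 0 :=
    cnt_eq_zero_of_forall c (hno va ua (Or.inl Sym2.eq_swap) fun h => huava (h.1.symm ▸ rfl))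
  have hcnt_b : c.cnt (toZ2 ub) (toZ2 vb) = 0 := by
    refine cnt_eq_zero_of_forall c (hno ub vb (Or.inr rfl) ?_)
    rintro ⟨h1, h2⟩
    exact hab (by rw [h1, h2])
  have hcnt_b' : c.cnt (toZ2 vb) (toZ2 ub) = 0 := by
    refine cnt_eq_zero_of_forall c (hno vb ub (Or.inr Sym2.eq_swap) ?_)
    rintro ⟨h1, h2⟩
    exact hab (by rw [h1, h2, Sym2.eq_swap])
  have hside : ∀ P Q : Site 2, ¬ (P ∈ B ∧ Q ∈ B) → ∀ j, ¬ (c.v j = toZ2 P ∧ c.v (j + 1) = toZ2 Q) := by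
    intro P Q hPQ j
    rw [hstep_iff]
    rintro ⟨rfl, rfl⟩
    exact hPQ ⟨hwB j, hwB (j + 1)⟩
  -- winding numbers: `0` on the two right faces
  have hWga : c.W (toZ2 (faceAt ua (ka + 3))) = 0 :=
    W_eq_zero_of_not_isInnerFace_of_adj hN0 hδ c w hcv hadjG hΩo hext hunb hfr ha.2 (isCorner_faceAt _ _)
      (E.zdBoundary_subset_meshDomain hua)
  have hWgb : c.W (toZ2 (faceAt ub (kb + 3))) = 0 :=
    W_eq_zero_of_not_isInnerFace_of_adj hN0 hδ c w hcv hadjG hΩo hext hunb hfr hb.2 (isCorner_faceAt _ _)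
      (E.zdBoundary_subset_meshDomain hub)
  -- `1` on the left face of `e_a`
  have hWσa : c.W (toZ2 (faceAt ua ka)) = 1 := by
    rw [W_faceAt_eq_add_one_of_cnt c hcnt_a hcnt_a', hWga, zero_add]
  -- constant along the chain of non-chord side steps
  have hchain : ∀ f, ReflTransGen (fun f f' : Site 2 =>
        (f' = f + cornerUnit 0 ∧ ¬ (f + cornerUnit 0 ∈ B ∧ f + cornerUnit 0 + cornerUnit 1 ∈ B)) ∨
        (f = f' + cornerUnit 0 ∧ ¬ (f' + cornerUnit 0 ∈ B ∧ f' + cornerUnit 0 + cornerUnit 1 ∈ B)) ∨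
        (f' = f + cornerUnit 1 ∧ ¬ (f + cornerUnit 1 ∈ B ∧ f + cornerUnit 0 + cornerUnit 1 ∈ B)) ∨
        (f = f' + cornerUnit 1 ∧ ¬ (f' + cornerUnit 1 ∈ B ∧ f' + cornerUnit 0 + cornerUnit 1 ∈ B)))
      (faceAt ua ka) f → c.W (toZ2 f) = 1 := by
    -- one step
    have e2 : ∀ f : Site 2, toZ2 (f + cornerUnit 0 + cornerUnit 1) = (f 0 + 1, f 1 + 1) := fun f => by
      rw [toZ2_add_cornerUnit_one]; simp [cornerUnit]
    have vert : ∀ f : Site 2, ¬ (f + cornerUnit 0 ∈ B ∧ f + cornerUnit 0 + cornerUnit 1 ∈ B) →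
        c.W (toZ2 (f + cornerUnit 0)) = c.W (toZ2 f) := by
      intro f hf
      have h1 := hside _ _ hf
      have h2 := hside (f + cornerUnit 0 + cornerUnit 1) (f + cornerUnit 0) (fun h => hf ⟨h.2, h.1⟩)
      rw [toZ2_add_cornerUnit_zero, toZ2_mk]
      simp only [e2, toZ2_add_cornerUnit_zero] at h1 h2
      rw [W_eq_of_not_step_vertical c (a := f 0 + 1) (q := f 1) h1 h2, add_sub_cancel_right]
    have horiz : ∀ f : Site 2, ¬ (f + cornerUnit 1 ∈ B ∧ f + cornerUnit 0 + cornerUnit 1 ∈ B) →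
        c.W (toZ2 (f + cornerUnit 1)) = c.W (toZ2 f) := by
      intro f hf
      have h1 := hside _ _ hf
      have h2 := hside (f + cornerUnit 0 + cornerUnit 1) (f + cornerUnit 1) (fun h => hf ⟨h.2, h.1⟩)
      rw [toZ2_add_cornerUnit_one, toZ2_mk]
      simp only [e2, toZ2_add_cornerUnit_one] at h1 h2
      rw [W_eq_of_not_step_horizontal c (p := f 0) (b := f 1 + 1) h1 h2, add_sub_cancel_right]
    intro f hf
    induction hf with
    | refl => exact hWσa
    | tail _ hstep ih =>
      rename_i f₁ f₂
      rcases hstep with ⟨rfl, h⟩ | ⟨rfl, h⟩ | ⟨rfl, h⟩ | ⟨rfl, h⟩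
      · rw [vert _ h, ih]
      · rw [← ih, vert _ h]
      · rw [horiz _ h, ih]
      · rw [← ih, horiz _ h]
  have hWσb : c.W (toZ2 (faceAt ub kb)) = 1 := hchain _ hreach
  -- but the winding number does not jump across `e_b`
  have := W_faceAt_eq_of_cnt c hcnt_b hcnt_b'
  rw [hWσb, hWgb] at this
  exact one_ne_zero this

end Summit.CriticalPhenomena.CardyFormulaZ2.Theorems.DiscretisationFamilyExists

end
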